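import Summits.MatrixMultiplication.MatrixMultiplication.Theorems.SoloInformedBoxTranslate

/-!
# THEOREM 8.22: the kernel part and the residual poor world, in one statement

This work, §8.8 (T13)(f),(g) and C3-m2 §6 (gen 107). Setting: a CU13-Def-12 realization of `⟨n,n,n⟩` in
`𝒮(S⁰ × S¹, ±)` [CohnUmans2013, arXiv:1207.6528, Def. 12] — equation data `D : Data ι G` (no 2-torsion), a chart
`Φ`, full separation, an exact class map `κ : G → R` (`κ x = κ y ⟺ x ∼ y`, `r = |R|`; the rank of the realization is
`|S⁰|·r = |G₀|·|R|`).

`Data.cube_le_or_residual` records, as ONE kernel theorem, how far the kernel proves THEOREM 8.22 (rank `≥ c·n³`):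
writing `A(j)`, `B(j)` for the number of values of column `j` of `a` and of row `j` of `b`, EITHER
* `n³ ≤ 3·r·|S⁰|` (a doubly-rich index, THEOREM 8.21*, `Data.cube_le_three_mul_of_doubly_rich`), OR
* `n² · #{j : A(j) ≥ 17} ≤ 3·r·|S⁰|` (a semi-rich base with a rich `b`-row, `…_of_semirich_row`), OR
* `n² · #{j : B(j) ≥ 17} ≤ 3·r·|S⁰|` (mirror), OR
* the RESIDUAL POOR WORLD: every `j` has `A(j) ≤ 17 ∨ B(j) ≤ 17`, every `j` with `B(j) ≥ 18` has `A(j) ≤ 9`, and every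
  `j` with `A(j) ≥ 18` has `B(j) ≤ 9` — the world treated on paper by the case trees of Theorems 8.20/8.20′ (whose
  leaves, and Theorem 8.19 in every class configuration, are kernel theorems).
-/

namespace Summit.MatrixMultiplication.MatrixMultiplication.Theorems.TwistedTPP

namespace FibreLines

variable {ι G : Type*} [AddCommGroup G]
variable {G₀ : Type*} [AddCommGroup G₀]

/-- **THEOREM 8.22, kernel part ∨ residual world.** [this work, §8.8 (T13); C3-m2 §6] -/
theorem Data.cube_le_or_residual [Fintype ι] [DecidableEq ι] [Fintype G₀] [DecidableEq G₀] [Fintype G]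
    [DecidableEq G] {R : Type*} [Fintype R] [DecidableEq R] (hG : ∀ x : G, x = -x → x = 0) (D : Data ι G)
    (Φ : Chart ι G₀) (κ : G → R) (hκ : ∀ x y, κ x = κ y ↔ SignEq x y) (hsep : D.SepAll Φ) :
    Fintype.card ι ^ 3 ≤ 3 * (Fintype.card R * Fintype.card G₀) ∨
    Fintype.card ι ^ 2 * ((Finset.univ : Finset ι).filter fun j =>
        17 ≤ ((Finset.univ : Finset ι).image fun i => D.a i j).card).card ≤
      3 * (Fintype.card R * Fintype.card G₀) ∨
    Fintype.card ι ^ 2 * ((Finset.univ : Finset ι).filter fun j =>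
        17 ≤ ((Finset.univ : Finset ι).image fun k => D.b j k).card).card ≤
      3 * (Fintype.card R * Fintype.card G₀) ∨
    ((∀ j, ((Finset.univ : Finset ι).image fun i => D.a i j).card ≤ 17 ∨
        ((Finset.univ : Finset ι).image fun k => D.b j k).card ≤ 17) ∧
      (∀ j, 18 ≤ ((Finset.univ : Finset ι).image fun k => D.b j k).card →
        ((Finset.univ : Finset ι).image fun i => D.a i j).card ≤ 9) ∧
      (∀ j, 18 ≤ ((Finset.univ : Finset ι).image fun i => D.a i j).card →
        ((Finset.univ : Finset ι).image fun k => D.b j k).card ≤ 9)) := by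
  by_cases h1 : ∃ j, 18 ≤ ((Finset.univ : Finset ι).image fun i => D.a i j).card ∧
      18 ≤ ((Finset.univ : Finset ι).image fun k => D.b j k).card
  · obtain ⟨j₀, ha, hb⟩ := h1
    exact Or.inl (D.cube_le_three_mul_of_doubly_rich hG Φ κ hκ hsep j₀ ha hb)
  by_cases h2 : ∃ j, 18 ≤ ((Finset.univ : Finset ι).image fun k => D.b j k).card ∧
      10 ≤ ((Finset.univ : Finset ι).image fun i => D.a i j).card
  · obtain ⟨j₀, hb, ha⟩ := h2
    exact Or.inr (Or.inl (D.sq_mul_card_le_three_mul_of_semirich_row hG Φ κ hκ hsep j₀ hb ha _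
      fun j hj => (Finset.mem_filter.1 hj).2))
  by_cases h3 : ∃ j, 18 ≤ ((Finset.univ : Finset ι).image fun i => D.a i j).card ∧
      10 ≤ ((Finset.univ : Finset ι).image fun k => D.b j k).card
  · obtain ⟨j₀, ha, hb⟩ := h3
    exact Or.inr (Or.inr (Or.inl (D.sq_mul_card_le_three_mul_of_semirich_col hG Φ κ hκ hsep j₀ ha hb _
      fun j hj => (Finset.mem_filter.1 hj).2)))
  push Not at h1 h2 h3
  refine Or.inr (Or.inr (Or.inr ⟨fun j => ?_, fun j hb => ?_, fun j ha => ?_⟩))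
  · by_contra h
    push Not at h
    exact absurd (h1 j (by omega)) (by omega)
  · have := h2 j hb; omega
  · have := h3 j ha; omega

end FibreLines

end Summit.MatrixMultiplication.MatrixMultiplication.Theorems.TwistedTPP
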